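import Summits.CriticalPhenomena.PercolationContinuityZ3.Theorems.PercNearOneGluingNoHeavyLowerTailSahiCombTriWAndLattice

/-!
# AND with an OR₃ block: `AndShellLower` for `Q = or3 = {y ⊆ Fin 3 | y ≠ ∅}` — the first block that needs LATTICE atoms

Support file of the one-cut programme (crux `NoHeavyLowerTail`, stmt-CriticalPhenomena-4575; unit `prim-lf-1` gen 45, memo
`FROM-prim-lf-1-gen45-AND-OR3.md`).  Continuation of `…SahiCombTriWAndOr2` (gen 43, `Q = or2`), `…SahiCombTriWAndOrAnd` (this gen, `Q = x₀ ∨ x₁x₂`)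
and `…SahiCombTriWAndLattice` (lattice row atoms).  The typed conjecture `AndShellLower` (`…SahiCombTriWAndProd`, gen 41) asks for the LOWER sandwich
bound of the sectionwise Formula-A score on `andProd P₁ Q`; here it is PROVED for `Q = or3` (`S_Q` = the six proper non-empty subsets, `E_Q = {⊤}`):
* **`lForm_le_scoreVal_andProd_or3`**: for every antipode-free up-set `P₁` with `Cor_{P₁} ≥ 0` on up-set pairs and all up-sets `A, B ⊆ 2^{γ₁ ⊕ Fin 3}`:
  `L_{P₁ ∧ or3}(A,B) ≤ Σ_B secFAScore P₁ or3`;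
* `scoreCert_andProd_or3`, **`triW_nonneg_andProd_or3`** (`TriWIneq` for `P₁ ∧ (x_a ∨ x_b ∨ x_c)` on every index cube, every intersecting Kleitman
  shell `P₁`), `…_of_klShell`, and the example `maj3 ∧ or3` (n = 6).
WHY LATTICE ATOMS.  With the unit atoms `[x⊔y∈A] − [xᶜ⊔y'∈A]` alone NO certificate exists for OR₃: the exact LP is infeasible (phase-1 optimum 1/3;
also with a free pointwise-non-negative remainder — Farkas witness in the memo).  The certificate below (found by an LP over conjunction/disjunction
recipes, kit job j192530, 20 integer terms, verified as an HONEST polynomial identity, no Boolean relations) uses the two lattice K-recipes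
`[x⊔{1,2} ∈ A] − [xᶜ⊔{1} ∈ A ∨ xᶜ⊔{2} ∈ A]` and `[x⊔{1} ∈ A] − [xᶜ⊔{1} ∈ A ∧ xᶜ⊔{2} ∈ A]` (`iOr`, `iAnd` of `…AndLattice`); each K-recipe
`x ↦ p(x) − q(xᶜ)` (`p ≥ q` monotone `{0,1}`-valued) is a unit K-vector, so K⊗K sums are `≥ 0` over `P₁` by acuteness (`sum_krec_mul_nonneg`); the
thirteen N⊗N products are pointwise `≥ 0` by family inclusion.
Row bookkeeping: `rowLowO3 = uu' + Σ_{y proper} d_y D_{yᶜ} + Σ_i e_i e_i'` with `e_i = [xᶜ⊔{i} ∈ A] − [xᶜ⊔{i}ᶜ ∈ A]`, and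
`Σ_B secFAScore − L = Σ_{x∈P₁} rowLowO3` (`scoreVal_sub_lForm_andProd_or3`).
HONEST LABEL: complete proofs, std axioms; `AndShellLower` for `Q = or3` only (the general conjecture and OR₄ stay OPEN). [this work]
-/

namespace Summit.CriticalPhenomena.PercolationContinuityZ3.Theorems

namespace FiveUpSet

open Finset

variable {β γ₁ : Type} [DecidableEq β] [Fintype β] [DecidableEq γ₁] [Fintype γ₁]

/-! ### The family `or3` -/

/-- `or3 = {y ⊆ Fin 3 | y ≠ ∅}` (the block `x₀ ∨ x₁ ∨ x₂`). [this work] -/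
def or3 : Finset (Finset (Fin 3)) := univ.filter fun y => y.Nonempty

/-- The seven elements of `or3`. [this work] -/
theorem or3_eq : or3 = {{0}, {1}, {0, 1}, {2}, {0, 2}, {1, 2}, univ} := by decide

/-- `or3` is an up-set. [this work] -/
theorem isUpperSet_or3 : IsUpperSet (or3 : Set (Finset (Fin 3))) := by
  intro y y' hyy' hy
  simp only [or3, coe_filter, mem_univ, true_and, Set.mem_setOf_eq] at hy ⊢
  exact hy.mono hyy'

/-- The symmetric core `or3 ∩ refl or3` = the six proper non-empty subsets. [this work] -/
theorem or3_inter_refl : or3 ∩ refl or3 = {{0}, {1}, {0, 1}, {2}, {0, 2}, {1, 2}} := by decide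

/-- The asymmetric part `or3 \ refl or3 = {⊤}`. [this work] -/
theorem or3_sdiff_refl : or3 \ refl or3 = {univ} := by decide

/-- `refl or3` = the seven proper subsets. [this work] -/
theorem refl_or3 : refl or3 = {∅, {0}, {1}, {0, 1}, {2}, {0, 2}, {1, 2}} := by decide

/-! ### The row defect of `P₁ ∧ or3` -/

/-- `e`-atom of the `xᶜ`-row: `[xᶜ⊔y ∈ A] − [xᶜ⊔yᶜ ∈ A]`. [this work] -/
def eW (A : Finset (Finset (γ₁ ⊕ Fin 3))) (y : Finset (Fin 3)) (x : Finset γ₁) : ℤ :=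
  ind A (xᶜ.disjSum y) - ind A (xᶜ.disjSum yᶜ)

/-- The row defect of the sectionwise Formula-A score on `P₁ ∧ or3` (per `x`):
`uu' + Σ_{y proper} d_y D_{yᶜ} + Σ_i e_i e_i'`. [this work] -/
def rowLowO3 (A B : Finset (Finset (γ₁ ⊕ Fin 3))) (x : Finset γ₁) : ℤ :=
  kat A univ ∅ x * kat B univ ∅ x
    + (kat A {0} {0} x * kat B {1, 2} {1, 2} x + kat A {1, 2} {1, 2} x * kat B {0} {0} x
      + kat A {1} {1} x * kat B {0, 2} {0, 2} x + kat A {0, 2} {0, 2} x * kat B {1} {1} x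
      + kat A {2} {2} x * kat B {0, 1} {0, 1} x + kat A {0, 1} {0, 1} x * kat B {2} {2} x)
    + (eW A {0} x * eW B {0} x + eW A {1} x * eW B {1} x + eW A {2} x * eW B {2} x)

/-! ### The row decomposition of `score − L` -/

omit [Fintype γ₁] in
/-- The score row of `P₁ ∧ or3`. [this work] -/
theorem score_rowO3 (A B : Finset (Finset (γ₁ ⊕ Fin 3))) (x : Finset γ₁) :
    (((or3 ∩ refl or3 ∩ secR B x ∩ refl (secR A x)).card : ℤ) + ((or3 \ refl or3) ∩ secR A x ∩ secR B x).card)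
      = ind B (x.disjSum {0}) * ind A (x.disjSum {1, 2}) + ind B (x.disjSum {1}) * ind A (x.disjSum {0, 2})
        + ind B (x.disjSum {0, 1}) * ind A (x.disjSum {2}) + ind B (x.disjSum {2}) * ind A (x.disjSum {0, 1})
        + ind B (x.disjSum {0, 2}) * ind A (x.disjSum {1}) + ind B (x.disjSum {1, 2}) * ind A (x.disjSum {0})
        + ind A (x.disjSum univ) * ind B (x.disjSum univ) := by
  rw [or3_inter_refl, or3_sdiff_refl, card_inter_inter_eq_sum_ind', card_singleton_inter_inter,
    sum_insert (by decide), sum_insert (by decide), sum_insert (by decide), sum_insert (by decide), sum_insert (by decide),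
    sum_singleton]
  simp only [ind_refl, ind_secR, compl_fin3_0, compl_fin3_1, compl_fin3_01, compl_fin3_2, compl_fin3_02, compl_fin3_12]
  ring

/-- First `L`-row: `#(or3 ∩ (refl A)_x ∩ B_x)`. [this work] -/
theorem lrowO3₁ (A B : Finset (Finset (γ₁ ⊕ Fin 3))) (x : Finset γ₁) :
    ((or3 ∩ secR (refl A) x ∩ secR B x).card : ℤ)
      = ind A (xᶜ.disjSum {1, 2}) * ind B (x.disjSum {0}) + ind A (xᶜ.disjSum {0, 2}) * ind B (x.disjSum {1})
        + ind A (xᶜ.disjSum {2}) * ind B (x.disjSum {0, 1}) + ind A (xᶜ.disjSum {0, 1}) * ind B (x.disjSum {2})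
        + ind A (xᶜ.disjSum {1}) * ind B (x.disjSum {0, 2}) + ind A (xᶜ.disjSum {0}) * ind B (x.disjSum {1, 2})
        + ind A (xᶜ.disjSum ∅) * ind B (x.disjSum univ) := by
  rw [card_inter_inter_eq_sum_ind', or3_eq, sum_insert (by decide), sum_insert (by decide), sum_insert (by decide),
    sum_insert (by decide), sum_insert (by decide), sum_insert (by decide), sum_singleton, secR_refl]
  simp only [ind_refl, ind_secR, compl_fin3_0, compl_fin3_1, compl_fin3_01, compl_fin3_2, compl_fin3_02, compl_fin3_12, compl_univ]
  ring

/-- Second `L`-row: `#(or3 ∩ A_x ∩ (refl B)_x)`. [this work] -/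
theorem lrowO3₂ (A B : Finset (Finset (γ₁ ⊕ Fin 3))) (x : Finset γ₁) :
    ((or3 ∩ secR A x ∩ secR (refl B) x).card : ℤ)
      = ind A (x.disjSum {0}) * ind B (xᶜ.disjSum {1, 2}) + ind A (x.disjSum {1}) * ind B (xᶜ.disjSum {0, 2})
        + ind A (x.disjSum {0, 1}) * ind B (xᶜ.disjSum {2}) + ind A (x.disjSum {2}) * ind B (xᶜ.disjSum {0, 1})
        + ind A (x.disjSum {0, 2}) * ind B (xᶜ.disjSum {1}) + ind A (x.disjSum {1, 2}) * ind B (xᶜ.disjSum {0})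
        + ind A (x.disjSum univ) * ind B (xᶜ.disjSum ∅) := by
  rw [card_inter_inter_eq_sum_ind', or3_eq, sum_insert (by decide), sum_insert (by decide), sum_insert (by decide),
    sum_insert (by decide), sum_insert (by decide), sum_insert (by decide), sum_singleton, secR_refl]
  simp only [ind_refl, ind_secR, compl_fin3_0, compl_fin3_1, compl_fin3_01, compl_fin3_2, compl_fin3_02, compl_fin3_12, compl_univ]
  ring

/-- Third `L`-row (antipodal rows): `#(refl or3 ∩ A_{xᶜ} ∩ B_{xᶜ})`. [this work] -/
theorem lrowO3₃ (A B : Finset (Finset (γ₁ ⊕ Fin 3))) (x : Finset γ₁) :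
    ((refl or3 ∩ secR A xᶜ ∩ secR B xᶜ).card : ℤ)
      = ind A (xᶜ.disjSum ∅) * ind B (xᶜ.disjSum ∅) + ind A (xᶜ.disjSum {0}) * ind B (xᶜ.disjSum {0})
        + ind A (xᶜ.disjSum {1}) * ind B (xᶜ.disjSum {1}) + ind A (xᶜ.disjSum {0, 1}) * ind B (xᶜ.disjSum {0, 1})
        + ind A (xᶜ.disjSum {2}) * ind B (xᶜ.disjSum {2}) + ind A (xᶜ.disjSum {0, 2}) * ind B (xᶜ.disjSum {0, 2})
        + ind A (xᶜ.disjSum {1, 2}) * ind B (xᶜ.disjSum {1, 2}) := by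
  rw [card_inter_inter_eq_sum_ind', refl_or3, sum_insert (by decide), sum_insert (by decide), sum_insert (by decide),
    sum_insert (by decide), sum_insert (by decide), sum_insert (by decide), sum_singleton]
  simp only [ind_secR]
  ring

/-- **Row decomposition**: `Σ_B secFAScore − L_{P₁ ∧ or3}(A,B) = Σ_{x∈P₁} rowLowO3 A B x`. [this work] -/
theorem scoreVal_sub_lForm_andProd_or3 (P₁ : Finset (Finset γ₁)) (A B : Finset (Finset (γ₁ ⊕ Fin 3))) :
    scoreVal (secFAScore P₁ or3) A B - lForm (andProd P₁ or3) A B = ∑ x ∈ P₁, rowLowO3 A B x := by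
  rw [scoreVal_secFAScore]
  unfold lForm
  rw [card_andProd_inter_inter, card_andProd_inter_inter, refl_andProd, card_andProd_inter_inter, sum_refl_eq]
  rw [← sum_add_distrib, ← sum_sub_distrib, ← sum_sub_distrib]
  refine sum_congr rfl fun x _ => ?_
  rw [score_rowO3, lrowO3₁, lrowO3₂, lrowO3₃]
  unfold rowLowO3 kat eW
  simp only [compl_fin3_0, compl_fin3_1, compl_fin3_2]
  ring

/-! ### The certificate -/

/-- **The certificate identity** for one row of `P₁ ∧ or3`: seven K⊗K products (two of them with lattice atoms) and thirteen N⊗N products,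
an honest polynomial identity. [this work] -/
theorem rowLowO3_eq_cert (A B : Finset (Finset (γ₁ ⊕ Fin 3))) (x : Finset γ₁) :
    rowLowO3 A B x =
      (ind A (x.disjSum {0}) - ind A (xᶜ.disjSum {0})) * (ind B (x.disjSum {1, 2}) - iOr B {1} {2} xᶜ)
        + (ind A (x.disjSum {1}) - iAnd A {1} {2} xᶜ) * (ind B (x.disjSum {0, 2}) - ind B (xᶜ.disjSum {0, 2}))
        + (ind A (x.disjSum {0, 1}) - ind A (xᶜ.disjSum {0, 1})) * (ind B (x.disjSum {2}) - ind B (xᶜ.disjSum ∅))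
        + (ind A (x.disjSum {2}) - ind A (xᶜ.disjSum ∅)) * (ind B (x.disjSum {0, 1}) - ind B (xᶜ.disjSum {0, 1}))
        + (ind A (x.disjSum {0, 2}) - ind A (xᶜ.disjSum {0, 2})) * (ind B (x.disjSum {1}) - iAnd B {1} {2} xᶜ)
        + (ind A (x.disjSum {1, 2}) - iOr A {1} {2} xᶜ) * (ind B (x.disjSum {0}) - ind B (xᶜ.disjSum {0}))
        + (ind A (x.disjSum univ) - ind A (xᶜ.disjSum {1, 2})) * (ind B (x.disjSum univ) - ind B (xᶜ.disjSum {1, 2}))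
        + (ind A (xᶜ.disjSum {0}) - ind A (xᶜ.disjSum ∅)) * (ind B (xᶜ.disjSum {0, 1}) - ind B (xᶜ.disjSum {1}))
        + (ind A (xᶜ.disjSum {1}) - ind A (xᶜ.disjSum ∅)) * (ind B (xᶜ.disjSum {1}) - ind B (xᶜ.disjSum ∅))
        + (ind A (xᶜ.disjSum {0, 1}) - ind A (xᶜ.disjSum {0})) * (ind B (xᶜ.disjSum {0, 1}) - ind B (xᶜ.disjSum {0}))
        + (ind A (xᶜ.disjSum {0, 1}) - ind A (xᶜ.disjSum {1})) * (ind B (xᶜ.disjSum {0}) - ind B (xᶜ.disjSum ∅))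
        + (ind A (xᶜ.disjSum {2}) - ind A (xᶜ.disjSum ∅)) * (ind B (x.disjSum univ) - ind B (x.disjSum {0, 1}))
        + (ind A (xᶜ.disjSum {2}) - iAnd A {1} {2} xᶜ) * (ind B (xᶜ.disjSum {0, 2}) - ind B (xᶜ.disjSum {0}))
        + (ind A (x.disjSum {0, 2}) - ind A (x.disjSum {0})) * (ind B (xᶜ.disjSum {1, 2}) - iOr B {1} {2} xᶜ)
        + (ind A (xᶜ.disjSum {0, 2}) - ind A (xᶜ.disjSum {0})) * (ind B (xᶜ.disjSum {2}) - iAnd B {1} {2} xᶜ)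
        + (ind A (xᶜ.disjSum {0, 2}) - ind A (xᶜ.disjSum {2})) * (ind B (xᶜ.disjSum {0, 2}) - ind B (xᶜ.disjSum {2}))
        + (ind A (xᶜ.disjSum {1, 2}) - ind A (xᶜ.disjSum {2})) * (ind B (x.disjSum univ) - ind B (x.disjSum {0, 2}))
        + (ind A (xᶜ.disjSum {1, 2}) - iOr A {1} {2} xᶜ) * (ind B (x.disjSum {0, 2}) - ind B (x.disjSum {0}))
        + (ind A (x.disjSum univ) - ind A (x.disjSum {0, 1})) * (ind B (xᶜ.disjSum {2}) - ind B (xᶜ.disjSum ∅))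
        + (ind A (x.disjSum univ) - ind A (x.disjSum {0, 2})) * (ind B (xᶜ.disjSum {1, 2}) - ind B (xᶜ.disjSum {2})) := by
  unfold rowLowO3 kat eW iAnd iOr
  simp only [compl_fin3_0, compl_fin3_1, compl_fin3_2]
  ring

/-! ### The theorem -/

section main
variable {P₁ : Finset (Finset γ₁)} (hP : IsUpperSet (P₁ : Set (Finset γ₁))) (hd : Disjoint P₁ (refl P₁))
  (hcor : ∀ U V : Finset (Finset γ₁), IsUpperSet (U : Set (Finset γ₁)) → IsUpperSet (V : Set (Finset γ₁)) → 0 ≤ corP P₁ U V)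
include hP hd hcor

/-- **THEOREM (`AndShellLower` for `Q = or3`).**  For every antipode-free up-set `P₁` with `Cor_{P₁} ≥ 0` on up-set pairs and all
up-sets `A, B`: `L_{P₁ ∧ or3}(A,B) ≤ Σ_B secFAScore P₁ or3`. [this work] -/
theorem lForm_le_scoreVal_andProd_or3 {A B : Finset (Finset (γ₁ ⊕ Fin 3))} (hA : IsUpperSet (A : Set (Finset (γ₁ ⊕ Fin 3))))
    (hB : IsUpperSet (B : Set (Finset (γ₁ ⊕ Fin 3)))) :
    lForm (andProd P₁ or3) A B ≤ scoreVal (secFAScore P₁ or3) A B := by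
  suffices h : 0 ≤ scoreVal (secFAScore P₁ or3) A B - lForm (andProd P₁ or3) A B by linarith
  rw [scoreVal_sub_lForm_andProd_or3, sum_congr rfl fun x _ => rowLowO3_eq_cert A B x]
  simp only [sum_add_distrib]
  have t1 : 0 ≤ ∑ x ∈ P₁, (ind A (x.disjSum {0}) - ind A (xᶜ.disjSum {0})) * (ind B (x.disjSum {1, 2}) - iOr B {1} {2} xᶜ) :=
    sum_krec_mul_nonneg hP hd hcor (fun W => ind A (W.disjSum {0})) (fun W => ind A (W.disjSum {0})) (fun W => ind B (W.disjSum {1, 2})) (fun W => iOr B {1} {2} W)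
      (fun W => ind_eq_zero_or_one A _) (fun W => ind_eq_zero_or_one A _) (fun W W' h => ind_mono_pt hA (disjSum_mono h (le_refl _)))
      (fun W W' h => ind_mono_pt hA (disjSum_mono h (le_refl _))) (fun W => ind_mono_pt hA (disjSum_mono (le_refl W) (by decide : ({0} : Finset (Fin 3)) ⊆ {0})))
      (fun W => ind_eq_zero_or_one B _) (fun W => iOr_eq_zero_or_one B _ _ W) (fun W W' h => ind_mono_pt hB (disjSum_mono h (le_refl _)))
      (fun W W' h => iOr_mono hB _ _ h) (fun W => iOr_le_ind hB (by decide : ({1} : Finset (Fin 3)) ⊆ {1, 2}) (by decide : ({2} : Finset (Fin 3)) ⊆ {1, 2}) W)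
  have t2 : 0 ≤ ∑ x ∈ P₁, (ind A (x.disjSum {1}) - iAnd A {1} {2} xᶜ) * (ind B (x.disjSum {0, 2}) - ind B (xᶜ.disjSum {0, 2})) :=
    sum_krec_mul_nonneg hP hd hcor (fun W => ind A (W.disjSum {1})) (fun W => iAnd A {1} {2} W) (fun W => ind B (W.disjSum {0, 2}))
      (fun W => ind B (W.disjSum {0, 2})) (fun W => ind_eq_zero_or_one A _) (fun W => iAnd_eq_zero_or_one A _ _ W)
      (fun W W' h => ind_mono_pt hA (disjSum_mono h (le_refl _))) (fun W W' h => iAnd_mono hA _ _ h)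
      (fun W => iAnd_le_ind hA (Or.inl (by decide : ({1} : Finset (Fin 3)) ⊆ {1})) W) (fun W => ind_eq_zero_or_one B _) (fun W => ind_eq_zero_or_one B _)
      (fun W W' h => ind_mono_pt hB (disjSum_mono h (le_refl _))) (fun W W' h => ind_mono_pt hB (disjSum_mono h (le_refl _)))
      (fun W => ind_mono_pt hB (disjSum_mono (le_refl W) (by decide : ({0, 2} : Finset (Fin 3)) ⊆ {0, 2})))
  have t3 : 0 ≤ ∑ x ∈ P₁, (ind A (x.disjSum {0, 1}) - ind A (xᶜ.disjSum {0, 1})) * (ind B (x.disjSum {2}) - ind B (xᶜ.disjSum ∅)) :=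
    sum_krec_mul_nonneg hP hd hcor (fun W => ind A (W.disjSum {0, 1})) (fun W => ind A (W.disjSum {0, 1})) (fun W => ind B (W.disjSum {2}))
      (fun W => ind B (W.disjSum ∅)) (fun W => ind_eq_zero_or_one A _) (fun W => ind_eq_zero_or_one A _) (fun W W' h => ind_mono_pt hA (disjSum_mono h (le_refl _)))
      (fun W W' h => ind_mono_pt hA (disjSum_mono h (le_refl _)))
      (fun W => ind_mono_pt hA (disjSum_mono (le_refl W) (by decide : ({0, 1} : Finset (Fin 3)) ⊆ {0, 1}))) (fun W => ind_eq_zero_or_one B _)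
      (fun W => ind_eq_zero_or_one B _) (fun W W' h => ind_mono_pt hB (disjSum_mono h (le_refl _))) (fun W W' h => ind_mono_pt hB (disjSum_mono h (le_refl _)))
      (fun W => ind_mono_pt hB (disjSum_mono (le_refl W) (by decide : (∅ : Finset (Fin 3)) ⊆ {2})))
  have t4 : 0 ≤ ∑ x ∈ P₁, (ind A (x.disjSum {2}) - ind A (xᶜ.disjSum ∅)) * (ind B (x.disjSum {0, 1}) - ind B (xᶜ.disjSum {0, 1})) :=
    sum_krec_mul_nonneg hP hd hcor (fun W => ind A (W.disjSum {2})) (fun W => ind A (W.disjSum ∅)) (fun W => ind B (W.disjSum {0, 1}))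
      (fun W => ind B (W.disjSum {0, 1})) (fun W => ind_eq_zero_or_one A _) (fun W => ind_eq_zero_or_one A _)
      (fun W W' h => ind_mono_pt hA (disjSum_mono h (le_refl _))) (fun W W' h => ind_mono_pt hA (disjSum_mono h (le_refl _)))
      (fun W => ind_mono_pt hA (disjSum_mono (le_refl W) (by decide : (∅ : Finset (Fin 3)) ⊆ {2}))) (fun W => ind_eq_zero_or_one B _)
      (fun W => ind_eq_zero_or_one B _) (fun W W' h => ind_mono_pt hB (disjSum_mono h (le_refl _))) (fun W W' h => ind_mono_pt hB (disjSum_mono h (le_refl _)))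
      (fun W => ind_mono_pt hB (disjSum_mono (le_refl W) (by decide : ({0, 1} : Finset (Fin 3)) ⊆ {0, 1})))
  have t5 : 0 ≤ ∑ x ∈ P₁, (ind A (x.disjSum {0, 2}) - ind A (xᶜ.disjSum {0, 2})) * (ind B (x.disjSum {1}) - iAnd B {1} {2} xᶜ) :=
    sum_krec_mul_nonneg hP hd hcor (fun W => ind A (W.disjSum {0, 2})) (fun W => ind A (W.disjSum {0, 2})) (fun W => ind B (W.disjSum {1}))
      (fun W => iAnd B {1} {2} W) (fun W => ind_eq_zero_or_one A _) (fun W => ind_eq_zero_or_one A _) (fun W W' h => ind_mono_pt hA (disjSum_mono h (le_refl _)))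
      (fun W W' h => ind_mono_pt hA (disjSum_mono h (le_refl _)))
      (fun W => ind_mono_pt hA (disjSum_mono (le_refl W) (by decide : ({0, 2} : Finset (Fin 3)) ⊆ {0, 2}))) (fun W => ind_eq_zero_or_one B _)
      (fun W => iAnd_eq_zero_or_one B _ _ W) (fun W W' h => ind_mono_pt hB (disjSum_mono h (le_refl _))) (fun W W' h => iAnd_mono hB _ _ h)
      (fun W => iAnd_le_ind hB (Or.inl (by decide : ({1} : Finset (Fin 3)) ⊆ {1})) W)
  have t6 : 0 ≤ ∑ x ∈ P₁, (ind A (x.disjSum {1, 2}) - iOr A {1} {2} xᶜ) * (ind B (x.disjSum {0}) - ind B (xᶜ.disjSum {0})) :=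
    sum_krec_mul_nonneg hP hd hcor (fun W => ind A (W.disjSum {1, 2})) (fun W => iOr A {1} {2} W) (fun W => ind B (W.disjSum {0})) (fun W => ind B (W.disjSum {0}))
      (fun W => ind_eq_zero_or_one A _) (fun W => iOr_eq_zero_or_one A _ _ W) (fun W W' h => ind_mono_pt hA (disjSum_mono h (le_refl _)))
      (fun W W' h => iOr_mono hA _ _ h) (fun W => iOr_le_ind hA (by decide : ({1} : Finset (Fin 3)) ⊆ {1, 2}) (by decide : ({2} : Finset (Fin 3)) ⊆ {1, 2}) W)
      (fun W => ind_eq_zero_or_one B _) (fun W => ind_eq_zero_or_one B _) (fun W W' h => ind_mono_pt hB (disjSum_mono h (le_refl _)))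
      (fun W W' h => ind_mono_pt hB (disjSum_mono h (le_refl _))) (fun W => ind_mono_pt hB (disjSum_mono (le_refl W) (by decide : ({0} : Finset (Fin 3)) ⊆ {0})))
  have t7 : 0 ≤ ∑ x ∈ P₁, (ind A (x.disjSum univ) - ind A (xᶜ.disjSum {1, 2})) * (ind B (x.disjSum univ) - ind B (xᶜ.disjSum {1, 2})) :=
    sum_krec_mul_nonneg hP hd hcor (fun W => ind A (W.disjSum univ)) (fun W => ind A (W.disjSum {1, 2})) (fun W => ind B (W.disjSum univ))
      (fun W => ind B (W.disjSum {1, 2})) (fun W => ind_eq_zero_or_one A _) (fun W => ind_eq_zero_or_one A _)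
      (fun W W' h => ind_mono_pt hA (disjSum_mono h (le_refl _))) (fun W W' h => ind_mono_pt hA (disjSum_mono h (le_refl _)))
      (fun W => ind_mono_pt hA (disjSum_mono (le_refl W) (by decide : ({1, 2} : Finset (Fin 3)) ⊆ univ))) (fun W => ind_eq_zero_or_one B _)
      (fun W => ind_eq_zero_or_one B _) (fun W W' h => ind_mono_pt hB (disjSum_mono h (le_refl _))) (fun W W' h => ind_mono_pt hB (disjSum_mono h (le_refl _)))
      (fun W => ind_mono_pt hB (disjSum_mono (le_refl W) (by decide : ({1, 2} : Finset (Fin 3)) ⊆ univ)))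
  have t8 : 0 ≤ ∑ x ∈ P₁, (ind A (xᶜ.disjSum {0}) - ind A (xᶜ.disjSum ∅)) * (ind B (xᶜ.disjSum {0, 1}) - ind B (xᶜ.disjSum {1})) :=
    sum_nonneg fun x _ => mul_nonneg (sub_nonneg.2 ((fun W => ind_mono_pt hA (disjSum_mono (le_refl W) (by decide : (∅ : Finset (Fin 3)) ⊆ {0}))) xᶜ)) (sub_nonneg.2
        ((fun W => ind_mono_pt hB (disjSum_mono (le_refl W) (by decide : ({1} : Finset (Fin 3)) ⊆ {0, 1}))) xᶜ))
  have t9 : 0 ≤ ∑ x ∈ P₁, (ind A (xᶜ.disjSum {1}) - ind A (xᶜ.disjSum ∅)) * (ind B (xᶜ.disjSum {1}) - ind B (xᶜ.disjSum ∅)) :=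
    sum_nonneg fun x _ => mul_nonneg (sub_nonneg.2 ((fun W => ind_mono_pt hA (disjSum_mono (le_refl W) (by decide : (∅ : Finset (Fin 3)) ⊆ {1}))) xᶜ)) (sub_nonneg.2
        ((fun W => ind_mono_pt hB (disjSum_mono (le_refl W) (by decide : (∅ : Finset (Fin 3)) ⊆ {1}))) xᶜ))
  have t10 : 0 ≤ ∑ x ∈ P₁, (ind A (xᶜ.disjSum {0, 1}) - ind A (xᶜ.disjSum {0})) * (ind B (xᶜ.disjSum {0, 1}) - ind B (xᶜ.disjSum {0})) :=
    sum_nonneg fun x _ => mul_nonneg (sub_nonneg.2 ((fun W => ind_mono_pt hA (disjSum_mono (le_refl W) (by decide : ({0} : Finset (Fin 3)) ⊆ {0, 1}))) xᶜ)) (sub_nonneg.2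
        ((fun W => ind_mono_pt hB (disjSum_mono (le_refl W) (by decide : ({0} : Finset (Fin 3)) ⊆ {0, 1}))) xᶜ))
  have t11 : 0 ≤ ∑ x ∈ P₁, (ind A (xᶜ.disjSum {0, 1}) - ind A (xᶜ.disjSum {1})) * (ind B (xᶜ.disjSum {0}) - ind B (xᶜ.disjSum ∅)) :=
    sum_nonneg fun x _ => mul_nonneg (sub_nonneg.2 ((fun W => ind_mono_pt hA (disjSum_mono (le_refl W) (by decide : ({1} : Finset (Fin 3)) ⊆ {0, 1}))) xᶜ)) (sub_nonneg.2
        ((fun W => ind_mono_pt hB (disjSum_mono (le_refl W) (by decide : (∅ : Finset (Fin 3)) ⊆ {0}))) xᶜ))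
  have t12 : 0 ≤ ∑ x ∈ P₁, (ind A (xᶜ.disjSum {2}) - ind A (xᶜ.disjSum ∅)) * (ind B (x.disjSum univ) - ind B (x.disjSum {0, 1})) :=
    sum_nonneg fun x _ => mul_nonneg (sub_nonneg.2 ((fun W => ind_mono_pt hA (disjSum_mono (le_refl W) (by decide : (∅ : Finset (Fin 3)) ⊆ {2}))) xᶜ)) (sub_nonneg.2
        ((fun W => ind_mono_pt hB (disjSum_mono (le_refl W) (by decide : ({0, 1} : Finset (Fin 3)) ⊆ univ))) x))
  have t13 : 0 ≤ ∑ x ∈ P₁, (ind A (xᶜ.disjSum {2}) - iAnd A {1} {2} xᶜ) * (ind B (xᶜ.disjSum {0, 2}) - ind B (xᶜ.disjSum {0})) :=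
    sum_nonneg fun x _ => mul_nonneg (sub_nonneg.2 ((fun W => iAnd_le_ind hA (Or.inr (by decide : ({2} : Finset (Fin 3)) ⊆ {2})) W) xᶜ)) (sub_nonneg.2
        ((fun W => ind_mono_pt hB (disjSum_mono (le_refl W) (by decide : ({0} : Finset (Fin 3)) ⊆ {0, 2}))) xᶜ))
  have t14 : 0 ≤ ∑ x ∈ P₁, (ind A (x.disjSum {0, 2}) - ind A (x.disjSum {0})) * (ind B (xᶜ.disjSum {1, 2}) - iOr B {1} {2} xᶜ) :=
    sum_nonneg fun x _ => mul_nonneg (sub_nonneg.2 ((fun W => ind_mono_pt hA (disjSum_mono (le_refl W) (by decide : ({0} : Finset (Fin 3)) ⊆ {0, 2}))) x)) (sub_nonneg.2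
        ((fun W => iOr_le_ind hB (by decide : ({1} : Finset (Fin 3)) ⊆ {1, 2}) (by decide : ({2} : Finset (Fin 3)) ⊆ {1, 2}) W) xᶜ))
  have t15 : 0 ≤ ∑ x ∈ P₁, (ind A (xᶜ.disjSum {0, 2}) - ind A (xᶜ.disjSum {0})) * (ind B (xᶜ.disjSum {2}) - iAnd B {1} {2} xᶜ) :=
    sum_nonneg fun x _ => mul_nonneg (sub_nonneg.2 ((fun W => ind_mono_pt hA (disjSum_mono (le_refl W) (by decide : ({0} : Finset (Fin 3)) ⊆ {0, 2}))) xᶜ)) (sub_nonneg.2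
        ((fun W => iAnd_le_ind hB (Or.inr (by decide : ({2} : Finset (Fin 3)) ⊆ {2})) W) xᶜ))
  have t16 : 0 ≤ ∑ x ∈ P₁, (ind A (xᶜ.disjSum {0, 2}) - ind A (xᶜ.disjSum {2})) * (ind B (xᶜ.disjSum {0, 2}) - ind B (xᶜ.disjSum {2})) :=
    sum_nonneg fun x _ => mul_nonneg (sub_nonneg.2 ((fun W => ind_mono_pt hA (disjSum_mono (le_refl W) (by decide : ({2} : Finset (Fin 3)) ⊆ {0, 2}))) xᶜ)) (sub_nonneg.2
        ((fun W => ind_mono_pt hB (disjSum_mono (le_refl W) (by decide : ({2} : Finset (Fin 3)) ⊆ {0, 2}))) xᶜ))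
  have t17 : 0 ≤ ∑ x ∈ P₁, (ind A (xᶜ.disjSum {1, 2}) - ind A (xᶜ.disjSum {2})) * (ind B (x.disjSum univ) - ind B (x.disjSum {0, 2})) :=
    sum_nonneg fun x _ => mul_nonneg (sub_nonneg.2 ((fun W => ind_mono_pt hA (disjSum_mono (le_refl W) (by decide : ({2} : Finset (Fin 3)) ⊆ {1, 2}))) xᶜ)) (sub_nonneg.2
        ((fun W => ind_mono_pt hB (disjSum_mono (le_refl W) (by decide : ({0, 2} : Finset (Fin 3)) ⊆ univ))) x))
  have t18 : 0 ≤ ∑ x ∈ P₁, (ind A (xᶜ.disjSum {1, 2}) - iOr A {1} {2} xᶜ) * (ind B (x.disjSum {0, 2}) - ind B (x.disjSum {0})) :=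
    sum_nonneg fun x _ => mul_nonneg (sub_nonneg.2 ((fun W => iOr_le_ind hA (by decide : ({1} : Finset (Fin 3)) ⊆ {1, 2}) (by decide : ({2} : Finset
        (Fin 3)) ⊆ {1, 2}) W) xᶜ)) (sub_nonneg.2 ((fun W => ind_mono_pt hB (disjSum_mono (le_refl W) (by decide : ({0} : Finset (Fin 3)) ⊆ {0, 2}))) x))
  have t19 : 0 ≤ ∑ x ∈ P₁, (ind A (x.disjSum univ) - ind A (x.disjSum {0, 1})) * (ind B (xᶜ.disjSum {2}) - ind B (xᶜ.disjSum ∅)) :=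
    sum_nonneg fun x _ => mul_nonneg (sub_nonneg.2 ((fun W => ind_mono_pt hA (disjSum_mono (le_refl W) (by decide : ({0, 1} : Finset (Fin 3)) ⊆ univ))) x)) (sub_nonneg.2
        ((fun W => ind_mono_pt hB (disjSum_mono (le_refl W) (by decide : (∅ : Finset (Fin 3)) ⊆ {2}))) xᶜ))
  have t20 : 0 ≤ ∑ x ∈ P₁, (ind A (x.disjSum univ) - ind A (x.disjSum {0, 2})) * (ind B (xᶜ.disjSum {1, 2}) - ind B (xᶜ.disjSum {2})) :=
    sum_nonneg fun x _ => mul_nonneg (sub_nonneg.2 ((fun W => ind_mono_pt hA (disjSum_mono (le_refl W) (by decide : ({0, 2} : Finset (Fin 3)) ⊆ univ))) x)) (sub_nonneg.2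
        ((fun W => ind_mono_pt hB (disjSum_mono (le_refl W) (by decide : ({2} : Finset (Fin 3)) ⊆ {1, 2}))) xᶜ))
  linarith [t1, t2, t3, t4, t5, t6, t7, t8, t9, t10, t11, t12, t13, t14, t15, t16, t17, t18, t19, t20]

/-- The sectionwise Formula-A score is a score certificate for `P₁ ∧ or3`. [this work] -/
theorem scoreCert_andProd_or3 : ScoreCert (andProd P₁ or3) (secFAScore P₁ or3) := fun _ _ hA hB =>
  ⟨lForm_le_scoreVal_andProd_or3 hP hd hcor hA hB, scoreVal_secFAScore_le_uForm hP isUpperSet_or3 hA hB⟩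

/-- **`TriWIneq` for `P₁ ∧ (x_a ∨ x_b ∨ x_c)`** on every index cube, for every intersecting Kleitman shell `P₁`. [this work] -/
theorem triW_nonneg_andProd_or3 (F G : Finset β → Finset (Finset (γ₁ ⊕ Fin 3)))
    (hF : ∀ x, IsUpperSet (F x : Set (Finset (γ₁ ⊕ Fin 3)))) (hG : ∀ x, IsUpperSet (G x : Set (Finset (γ₁ ⊕ Fin 3))))
    (hFm : Monotone F) (hGm : Monotone G) :
    0 ≤ triW (andProd P₁ or3) F G :=
  triW_nonneg_of_scoreCert (monoScore_secFAScore P₁ or3) (scoreCert_andProd_or3 hP hd hcor) F G hF hG hFm hGm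

end main

/-- The same with the hypothesis on `P₁` in Kleitman-shell form. [this work] -/
theorem triW_nonneg_andProd_or3_of_klShell {P₁ : Finset (Finset γ₁)} (hP : IsUpperSet (P₁ : Set (Finset γ₁)))
    (hd : Disjoint P₁ (refl P₁)) (hs : KlShell (P₁ ∪ refl P₁)) (F G : Finset β → Finset (Finset (γ₁ ⊕ Fin 3)))
    (hF : ∀ x, IsUpperSet (F x : Set (Finset (γ₁ ⊕ Fin 3)))) (hG : ∀ x, IsUpperSet (G x : Set (Finset (γ₁ ⊕ Fin 3))))
    (hFm : Monotone F) (hGm : Monotone G) :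
    0 ≤ triW (andProd P₁ or3) F G :=
  triW_nonneg_andProd_or3 hP hd (fun U V hU hV => by rw [corP_eq_card_sub_card_of_disjoint hd]; exact hs U V hU hV) F G hF hG hFm hGm

/-- Example: `maj3 ∧ or3` = `maj(x,y,z) · (a ∨ b ∨ c)` (n = 6). [this work] -/
theorem triW_nonneg_maj3_andProd_or3 (F G : Finset β → Finset (Finset (Fin 3 ⊕ Fin 3)))
    (hF : ∀ x, IsUpperSet (F x : Set (Finset (Fin 3 ⊕ Fin 3)))) (hG : ∀ x, IsUpperSet (G x : Set (Finset (Fin 3 ⊕ Fin 3))))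
    (hFm : Monotone F) (hGm : Monotone G) :
    0 ≤ triW (andProd maj3 or3) F G :=
  triW_nonneg_andProd_or3 isUpperSet_maj3 disjoint_maj3_refl (fun _ _ hU hV => corP_nonneg_of_selfDual maj3_selfDual hU hV)
    F G hF hG hFm hGm

end FiveUpSet

end Summit.CriticalPhenomena.PercolationContinuityZ3.Theorems
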